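import Literature.MathematicalPhysics.KineticTheory.HardSphereEulerProofs
import Mathlib.Dynamics.Ergodic.MeasurePreserving
import Mathlib.MeasureTheory.Measure.WithDensity

/-!
# Crux `AprioriBounds` (stmt-AtomisticToContinuum-14827) — ideator 2, round 1: first lemmas of the
two COUNTING cards (`fibre-deficit-transfer`, `counting-second-law`)

Namespace `Summit.AtomisticToContinuum.HydrodynamicLimit.Cruxes.AprioriBounds.Counting`.

§1 (PROVED, abstract measure theory) the three-line engine common to both cards:
* `withDensity_le_superlevel_add` — a law with density `f` w.r.t. `vol` charges ANY measurable set
  `E` by at most `μ₀{c < f} + c · vol E` ("typicality versus volume");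
* `volume_smallFibre_le` — the union of all fibres of a finite macrostate map whose volume is
  `< κ` has volume `≤ #𝓑 · κ` (Boltzmann counting);
* `countingSecondLaw` — for a `vol`-preserving map `T` (one time of a hard-sphere flow):
  `μ₀ (T ⁻¹' {z | vol (fibre of z) < κ}) ≤ μ₀ {c < f} + c · #𝓑 · κ`.
  With `c = e^{-S(μ₀)+a/2}`, `κ = e^{S(μ₀)-a}` this is the SECOND LAW FOR THE BOLTZMANN ENTROPY OF
  THE REALISED MACROSTATE, w.h.p., at precision `a ≍ log #𝓑` — no invariant measure, no
  large-deviation principle, no autonomy of the macroscopic evolution.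
§2 (PROVED) the instantiation on the tree's objects: `localGibbsLaw σ a₀ u₀ θ₀ N Φ` is
  `liouville.withDensity (ofReal ∘ canonicalDensity …)` by `rfl`, and `(Φ N).flow s` preserves
  `liouville` (`HardSphereFlow.measurePreserving`), so `countingSecondLaw_localGibbs` holds for every
  finite measurable macrostate map on `Config (N+1) (Fin 3) 𝕋³`, every `s`, every `κ, c`.
§3 (TYPED, not proved) the dynamical input shared by both cards, `LinearHydroRate a`: the FIVE
  tested linear statistics of the kernel block fields against the conjugate fields of the classical
  solution converge at a polynomial rate `(N+1)^{-a}` with polynomially small failure probability,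
  under the crux's own prefix (classical hs-Euler solution + LLN data + dilute chamber).
-/

noncomputable section

open MeasureTheory Filter Set Topology
open scoped ENNReal

namespace Summit.AtomisticToContinuum.HydrodynamicLimit.Cruxes.AprioriBounds.Counting

/-! ## §1 The abstract counting engine -/

section Abstract

variable {Ω : Type*} [MeasurableSpace Ω]

/-- **Typicality versus volume.** A measure with density `f` charges a measurable set `E` by at
most its mass above level `c` plus `c` times the reference volume of `E`. -/
theorem withDensity_le_superlevel_add (vol : Measure Ω) {f : Ω → ℝ≥0∞} (hf : Measurable f)
    {E : Set Ω} (hE : MeasurableSet E) (c : ℝ≥0∞) :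
    vol.withDensity f E ≤ vol.withDensity f {z | c < f z} + c * vol E := by
  have hlt : MeasurableSet {z | c < f z} := measurableSet_lt measurable_const hf
  rw [withDensity_apply f hE, withDensity_apply f hlt]
  have hpt : ∀ z, f z ≤ {z | c < f z}.indicator f z + c := by
    intro z
    by_cases h : c < f z
    · rw [indicator_of_mem (show z ∈ {z | c < f z} from h)]
      exact le_self_add
    · rw [indicator_of_notMem (show z ∉ {z | c < f z} from h)]
      simpa using not_lt.mp h
  calc ∫⁻ z in E, f z ∂vol
      ≤ ∫⁻ z in E, ({z | c < f z}.indicator f z + c) ∂vol := lintegral_mono fun z => hpt z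
    _ = (∫⁻ z in E, {z | c < f z}.indicator f z ∂vol) + ∫⁻ _ in E, c ∂vol :=
        lintegral_add_right _ measurable_const
    _ = (∫⁻ z in E, {z | c < f z}.indicator f z ∂vol) + c * vol E := by rw [setLIntegral_const]
    _ ≤ (∫⁻ z, {z | c < f z}.indicator f z ∂vol) + c * vol E :=
        add_le_add (setLIntegral_le_lintegral _ _) le_rfl
    _ = (∫⁻ z in {z | c < f z}, f z ∂vol) + c * vol E := by rw [lintegral_indicator hlt]

variable {B : Type*} [Fintype B] [MeasurableSpace B] [MeasurableSingletonClass B]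

/-- The **fibre volume** (Boltzmann's `W`) of the macrostate of `z` under a macrostate map `M`. -/
def fibreVolume (vol : Measure Ω) (M : Ω → B) (z : Ω) : ℝ≥0∞ := vol (M ⁻¹' {M z})

/-- The set of microstates whose macrostate has fibre volume `< κ` (Boltzmann entropy
`log W < log κ`). -/
def smallFibreSet (vol : Measure Ω) (M : Ω → B) (κ : ℝ≥0∞) : Set Ω :=
  {z | fibreVolume vol M z < κ}

omit [Fintype B] [MeasurableSpace B] [MeasurableSingletonClass B] in
theorem smallFibreSet_eq_preimage (vol : Measure Ω) (M : Ω → B) (κ : ℝ≥0∞) :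
    smallFibreSet vol M κ = M ⁻¹' {b | vol (M ⁻¹' {b}) < κ} := rfl

theorem measurableSet_smallFibreSet (vol : Measure Ω) {M : Ω → B} (hM : Measurable M)
    (κ : ℝ≥0∞) : MeasurableSet (smallFibreSet vol M κ) := by
  rw [smallFibreSet_eq_preimage]
  exact hM (MeasurableSet.of_discrete)

omit [MeasurableSpace B] [MeasurableSingletonClass B] in
/-- **Boltzmann counting.** The microstates sitting in fibres of volume `< κ` have total volume at
most `#𝓑 · κ`. -/
theorem volume_smallFibreSet_le (vol : Measure Ω) (M : Ω → B) (κ : ℝ≥0∞) :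
    vol (smallFibreSet vol M κ) ≤ Fintype.card B * κ := by
  classical
  have hsub : smallFibreSet vol M κ ⊆ ⋃ b : B, (if vol (M ⁻¹' {b}) < κ then M ⁻¹' {b} else ∅) := by
    intro z hz
    simp only [mem_iUnion]
    refine ⟨M z, ?_⟩
    have h : vol (M ⁻¹' {M z}) < κ := hz
    rw [if_pos h]
    exact rfl
  calc vol (smallFibreSet vol M κ)
      ≤ vol (⋃ b : B, (if vol (M ⁻¹' {b}) < κ then M ⁻¹' {b} else ∅)) := measure_mono hsub
    _ ≤ ∑ b : B, vol (if vol (M ⁻¹' {b}) < κ then M ⁻¹' {b} else ∅) :=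
        measure_iUnion_fintype_le vol _
    _ ≤ ∑ _b : B, κ := by
        refine Finset.sum_le_sum fun b _ => ?_
        by_cases h : vol (M ⁻¹' {b}) < κ
        · rw [if_pos h]; exact h.le
        · rw [if_neg h]; simp
    _ = Fintype.card B * κ := by
        rw [Finset.sum_const, Finset.card_univ, nsmul_eq_mul]

/-- **Counting second law (abstract).** Let `μ₀ = f · vol`, let `T` preserve `vol` (one time of the
flow) and let `M` be a finite measurable macrostate map. Then the probability, under the EVOLVED
law, that the realised macrostate has fibre volume `< κ` is at most `μ₀{c < f} + c · #𝓑 · κ`, for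
every level `c`. (Choose `c = e^{-S+a/2}`, `κ = e^{S-a}` with `S` the Gibbs entropy of `μ₀`: the
first term is a lower deviation of the information content `-log f` below `S - a/2`, the second is
`#𝓑 e^{-a/2}`.) -/
theorem countingSecondLaw (vol : Measure Ω) {f : Ω → ℝ≥0∞} (hf : Measurable f) {T : Ω → Ω}
    (hT : MeasurePreserving T vol vol) {M : Ω → B} (hM : Measurable M) (κ c : ℝ≥0∞) :
    vol.withDensity f (T ⁻¹' smallFibreSet vol M κ)
      ≤ vol.withDensity f {z | c < f z} + c * (Fintype.card B * κ) := by
  have hA : MeasurableSet (smallFibreSet vol M κ) := measurableSet_smallFibreSet vol hM κ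
  have hTA : MeasurableSet (T ⁻¹' smallFibreSet vol M κ) := hT.measurable hA
  calc vol.withDensity f (T ⁻¹' smallFibreSet vol M κ)
      ≤ vol.withDensity f {z | c < f z} + c * vol (T ⁻¹' smallFibreSet vol M κ) :=
        withDensity_le_superlevel_add vol hf hTA c
    _ = vol.withDensity f {z | c < f z} + c * vol (smallFibreSet vol M κ) := by
        rw [hT.measure_preimage hA.nullMeasurableSet]
    _ ≤ vol.withDensity f {z | c < f z} + c * (Fintype.card B * κ) := by
        gcongr
        exact volume_smallFibreSet_le vol M κ

end Abstract

/-! ## §2 Instantiation on the tree: local Gibbs data, hard-sphere flow, any finite macrostate map -/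

section HardSpheres

open Literature.MathematicalPhysics.KineticTheory Literature.Analysis.FluidPDE

/-- The Liouville measure of `N + 1` spheres of reduced diameter `σ` on `𝕋³` (abbreviation). -/
abbrev liou (σ : ℝ) (N : ℕ) : Measure (Config (N + 1) (Fin 3) T3) :=
  liouville (Torus.geometry (Fin 3)) (N + 1) (hsDiameter σ N)

/-- The local Gibbs density w.r.t. Liouville, as an `ℝ≥0∞`-valued function (abbreviation). -/
abbrev lgDensity (σ : ℝ) (a₀ : T3 → ℝ) (u₀ : T3 → V3) (θ₀ : T3 → ℝ) (N : ℕ) :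
    Config (N + 1) (Fin 3) T3 → ℝ≥0∞ :=
  fun z => ENNReal.ofReal (canonicalDensity (Torus.geometry (Fin 3)) (hsDiameter σ N) (N + 1)
    (localGibbsProfile a₀ u₀ θ₀) z)

/-- The local Gibbs law IS `liouville.withDensity lgDensity` (definitional). -/
theorem localGibbsLaw_eq_withDensity (σ : ℝ) (a₀ : T3 → ℝ) (u₀ : T3 → V3) (θ₀ : T3 → ℝ) (N : ℕ)
    (Φ : HardSphereFlow (Torus.geometry (Fin 3)) (hsDiameter σ N) (N + 1)) :
    localGibbsLaw σ a₀ u₀ θ₀ N Φ = (liou σ N).withDensity (lgDensity σ a₀ u₀ θ₀ N) := rfl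

variable {B : Type*} [Fintype B] [MeasurableSpace B] [MeasurableSingletonClass B]

/-- **Counting second law for deterministic hard spheres from local Gibbs data.** For every flow,
every time `s`, every finite measurable macrostate map `M` on `(N+1)`-sphere phase space and all
levels `κ, c`: the local-Gibbs probability that the configuration AT TIME `s` lies in a macrostate of
Liouville volume `< κ` is at most `P₀{c < f₀} + c · #𝓑 · κ` (`f₀` the local Gibbs density). No
property of the dynamics is used beyond Liouville invariance of ONE time-`s` map. -/
theorem countingSecondLaw_localGibbs (σ : ℝ) (a₀ : T3 → ℝ) (u₀ : T3 → V3) (θ₀ : T3 → ℝ) (N : ℕ)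
    (Φ : HardSphereFlow (Torus.geometry (Fin 3)) (hsDiameter σ N) (N + 1))
    (hmeas : Measurable (lgDensity σ a₀ u₀ θ₀ N))
    {M : Config (N + 1) (Fin 3) T3 → B} (hM : Measurable M) (s : ℝ) (κ c : ℝ≥0∞) :
    localGibbsLaw σ a₀ u₀ θ₀ N Φ {z | Φ.flow s z ∈ smallFibreSet (liou σ N) M κ}
      ≤ localGibbsLaw σ a₀ u₀ θ₀ N Φ {z | c < lgDensity σ a₀ u₀ θ₀ N z}
        + c * (Fintype.card B * κ) := by
  rw [localGibbsLaw_eq_withDensity]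
  exact countingSecondLaw (liou σ N) hmeas (Φ.measurePreserving s) hM κ c

end HardSpheres

/-! ## §3 The shared dynamical input, typed: five tested linear statistics at a polynomial rate -/

section Inputs

open Literature.MathematicalPhysics.KineticTheory Literature.Analysis.FluidPDE
  Literature.Analysis.FunctionSpaces

/-- **`LinearHydroRate a`** (the ONE dynamical input of both counting cards). Under the crux's own
prefix (profiles, `σ < σ₀`, classical hs-Euler solution `(ρ,u,θ)` on `[0,T)` with LLN data, flow
family, admissible kernel family at scale `(N+1)^{-γ}`, `0 < t < T`, dilute chamber
`2ρσ³ < η₁` on `[0,t]`): for the conjugate (entropy-variable) fields `Λ(s,·) = Dη_σ(U_cl(s,·))` of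
the classical solution — FIVE fixed smooth test functions per time — the tested linear statistic
`∫ Λ(s,x) · (Ū_N(s,x) − U_cl(s,x)) dx` of the kernel block fields is `≤ (N+1)^{-a}` except on an
event of probability `≤ (N+1)^{-a}`, uniformly in `s ≤ t`. (Fluctuation floor `N^{-1/2}`;
Chapman–Enskog systematic part `N^{-1/3}`; so every `a < 1/3` is consistent with kinetic theory.
It is a quantitative hydrodynamic limit for five test functions and is produced, in a time
bootstrap, by the route's Dafermos bookkeeping fed with TESTED defect rates.) -/
def LinearHydroRate (a : ℝ) : Prop :=
  ∀ (a₀ θ₀ : T3 → ℝ) (u₀ : T3 → V3), Continuous a₀ → Continuous θ₀ → Continuous u₀ →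
    (∀ x, 0 < a₀ x) → (∀ x, 0 < θ₀ x) →
    ∃ σ₀ : ℝ, 0 < σ₀ ∧ ∃ η₁ : ℝ, 0 < η₁ ∧ ∀ σ : ℝ, 0 < σ → σ < σ₀ →
    ∀ (T : ℝ) (ρ θ : ℝ → T3 → ℝ) (u : ℝ → T3 → V3), IsHardSphereEulerSolution σ T ρ u θ →
    ∀ Φ : (N : ℕ) → HardSphereFlow (Torus.geometry (Fin 3)) (hsDiameter σ N) (N + 1),
    TendstoHydroFieldsAt (fun N => localGibbsLaw σ a₀ u₀ θ₀ N (Φ N)) Φ ρ u θ 0 →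
    ∀ (γ C : ℝ) (φ : ℕ → T3 → ℝ), 0 < γ → γ ≤ 1 / 15 →
    ((∀ N, Torus.IsSmooth (φ N)) ∧ (∀ N y, 0 ≤ φ N y) ∧ (∀ N, ∫ y, φ N y = 1) ∧
      (∀ (N : ℕ) y, ((N : ℝ) + 1) ^ (-γ) ≤ Torus.euclidDist y 0 → φ N y = 0) ∧
      (∀ (N : ℕ) y, φ N y ≤ C * ((N : ℝ) + 1) ^ (3 * γ)) ∧
      (∀ (N : ℕ) y, ‖Torus.gradient (φ N) y‖ ≤ C * ((N : ℝ) + 1) ^ (4 * γ))) →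
    ∀ t : ℝ, 0 < t → t < T → (∀ s ∈ Icc 0 t, ∀ x, 2 * ρ s x * σ ^ 3 < η₁) →
    let ησ := fun U : ℝ × V3 × ℝ =>
      -(U.1 * (3 / 2 * Real.log (2 / 3 * (U.2.2 / U.1 - ‖U.2.1‖ ^ 2 / (2 * U.1 ^ 2)))
        - Real.log U.1 - hsExcessFreeEnergy (U.1 * σ ^ 3)))
    let Ucl := fun (s : ℝ) (x : T3) => ((ρ s x, ρ s x • u s x, totalEnergyDensity (ρ s x) (u s x) (θ s x)) : ℝ × V3 × ℝ)
    let Λ := fun (s : ℝ) (x : T3) => fderiv ℝ ησ (Ucl s x)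
    let Ub := fun (N : ℕ) (z : Config (N + 1) (Fin 3) T3) (x : T3) =>
      ((empiricalDensityField z (fun y => φ N (y - x)),
        empiricalMomentumField z (fun y => φ N (y - x)),
        empiricalEnergyField z (fun y => φ N (y - x))) : ℝ × V3 × ℝ)
    ∃ N₀ : ℕ, ∀ N ≥ N₀, ∀ s ∈ Icc 0 t,
      localGibbsLaw σ a₀ u₀ θ₀ N (Φ N)
        {z | ((N : ℝ) + 1) ^ (-a) < |∫ x, Λ s x (Ub N ((Φ N).flow s z) x - Ucl s x)|}
        ≤ ENNReal.ofReal (((N : ℝ) + 1) ^ (-a))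

end Inputs

end Summit.AtomisticToContinuum.HydrodynamicLimit.Cruxes.AprioriBounds.Counting

end
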